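import Summits.HodgeConjecture.HodgeConjecture.Theses.EisensteinMiddleThird
import Literature.AlgebraicGeometry.HodgeTheory.BallQuotientCompactification
import Literature.AlgebraicGeometry.ShimuraVarieties.EisensteinUnitaryLevel
import Literature.AlgebraicGeometry.Resolution.ResolutionOfSingularities
import Literature.Geometry.Kaehler.LefschetzOperator
import Literature.AlgebraicTopology.SingularHomology.ExcisionMayerVietoris
import HarnessLib

/-!
# Birth skeleton — piece X₂ `TowerCuspidalMiddle` of the split of `EisensteinTowerHodge`
# (stmt-HodgeConjecture-19001; route EisensteinMiddleThird, crux-strategist 2026-08-17)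

Line **Lefschetz–sl₂ triage of the interior `(2,2)`-classes**. The piece says: for `X` in the
Eisenstein Picard-modular sector with boundary `Z`, a rational `(2,2)`-class `c` killed by every
smooth projective threefold mapping into `Z` (i.e. coming from `H⁴_c(U)`, `U = X ∖ Z ≅ Γ'\𝔹⁴`: an
INTERIOR class, `c|_U ∈ H⁴_!(U) = IH⁴(X^BB) = H⁴_(2)`) is algebraic modulo classes supported on `Z`
(`(c - a)|_U = 0`). The interior `(2,2)`-classes of a `U(4,1)`-quotient come from three
`(𝔤,K)`-types: `𝟙 ⊗ L²` (Kähler powers), `A_{1,1} ⊗ L` (Lefschetz images of interior `(1,1)`-classes)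
and the discrete-series type `A_{2,2}` (primitive, middle degree) — the sl₂ of the Baily–Borel class
`ℓ` on `IH•(X^BB)` separates them over `ℚ`. Plan:

1. `stub_bailyBorelTriageChart` (AMRT/Baily–Borel + Zucker–Looijenga–Saper–Stern hard Lefschetz on
   `IH•(X^BB)` + Deligne purity of `IH² = H²(U)` + Hironaka domination; existence, known
   mathematics, L-sized): every sector member is joined by a common modification to a sector member
   `X'` (same deck set `S`) carrying a rational divisor class `ℓ` (pull-back of `𝒪_{X^BB}(1)`) with
   `ℓ|_{Z'(ℂ)} = 0`, `ℓ⁴ ≠ 0`, such that every interior rational `(2,2)`-class `c` of `X'` splits as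
   `c ≡ a + c₀ (mod classes supported on Z')` with `a` rational ALGEBRAIC (the part `ℓ ∪ η`,
   `η ∈ NS(X')_ℚ`: Kähler and `A_{1,1} ⊗ L` types, via hard Lefschetz on `IH` and Lefschetz (1,1))
   and `c₀` an interior rational `(2,2)`-class which is `ℓ`-PRIMITIVE (`ℓ ∪ θ ∪ c₀ = 0 ∈ H⁸(X')` for
   all `θ ∈ H²(X')` — the intersection-pairing form of primitivity in `IH⁴`).
2. `stub_primitiveInteriorCore` (THE OPEN HEART — BMM's excluded middle third, arXiv:1306.1515
   Cor. 2; discrete-series `A_{2,2}` contributions incl. θ-deficient `Π₄ ⊞ χ` and endoscopic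
   packets): on a sector member with such an `ℓ`, every `ℓ`-primitive interior rational
   `(2,2)`-class is algebraic modulo classes supported on the boundary. Supplies: primitive
   projections of Kudla–Millson special surfaces (`HodgeTheory.specialCycleSpan A π 𝓔⁵ 2`), Hecke
   translates of the exotic moduli cycles (Allcock–Carlson–Toledo).
3. `stub_interiorTransfer` (M-sized): "interior rational `(2,2)`-classes are algebraic modulo the
   boundary" passes from `(X', Z')` to `(X, Z)` along a common modification `X ⟵p X'' ⟶q X'`
   (`p^*c = q^*c'` by relative-homeomorphism excision `H⁴(X'',Z'') ≅ H⁴(X',Z')`, both in the tree;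
   `a := p_* q^* a'`; `p_*` commutes with restriction to `U` over which `p` is an isomorphism). No
   coniveau input is needed on this side.
4. `stub_vanishOfTests` (Deligne Hodge III Prop. 8.2.7 + resolution + `× ℙʳ` padding; M-sized): a
   class of `H⁴(X)` killed by every smooth projective threefold mapping into the closed `Z ⊊ X`
   vanishes on `Z(ℂ)` (the tree's named fact `Deligne1974_ker_pullback_eq_ker_pullback_resolution`
   applied to padded resolutions of the components of `Z`, plus tautness of `Z(ℂ)`).

Composition `towerCuspidalMiddle_of` (no sorry): name the sector hypothesis; tests ⇒ `c|_{Z(ℂ)} = 0`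
(stub 4); chart (stub 1); on `X'`: triage + core give the interior property (closure of rational /
algebraic classes under `+`, linearity of `restrictCompl`); transfer to `X` (stub 3).
-/

noncomputable section

set_option linter.dupNamespace false

namespace Summit.HodgeConjecture.HodgeConjecture.Cruxes.EisensteinTowerHodge.SplitCuspidal

open scoped BigOperators Topology Manifold Classical Matrix InnerProductSpace ComplexConjugate
open CategoryTheory AlgebraicGeometry
open Literature.AlgebraicGeometry Literature.AlgebraicGeometry.Motives
  Literature.AlgebraicGeometry.HodgeTheory Literature.AlgebraicTopology.SingularHomology
  Literature.AlgebraicGeometry.ShimuraVarieties Literature.Geometry.Kaehler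

/-- The interior property of the pair `(X, Z)` (conclusion shape of the piece, hypothesis in the
form "dies on `Z(ℂ)`"): every rational `(2,2)`-class of `X` vanishing on the complex points of `Z`
is algebraic modulo classes supported on `Z`. -/
def InteriorAlgebraic (X : SchemeOver ℂ) (Z : Set X.left) : Prop :=
  ∀ c : complexBetti X (2 * 2), IsRationalClass c → IsOfHodgeType 4 X (2 * 2) 2 2 c →
    singularCohomology.map ℂ ℂ (subsetIncl {P : ComplexPoints X | P.pt ∈ Z}) (2 * 2) c = 0 →
    ∃ a ∈ algebraicClasses X 2, IsRationalClass a ∧ complexBetti.restrictCompl X Z (2 * 2) (c - a) = 0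

/-- `c₀ ∈ H⁴(X')` is `ℓ`-primitive in the intersection-pairing sense: `ℓ ∪ θ ∪ c₀ = 0` in the top
cohomology `H⁸(X'(ℂ); ℂ)` for every `θ ∈ H²(X')` (for the Baily–Borel class `ℓ` and an interior
`c₀` this is primitivity in `IH⁴(X^BB)`: `IH⁶ × IH²` is a perfect pairing and `H²(X') ↠ H²(U) = IH²`). -/
def IsEllPrimitive (X' : SchemeOver ℂ) (ℓ : complexBetti X' 2) (c₀ : complexBetti X' (2 * 2)) : Prop :=
  ∀ θ : complexBetti X' 2,
    cupProduct (show 2 * 2 + 2 * 2 = 8 by norm_num)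
      (lefschetzOperator ℓ (show 2 + 2 = 2 * 2 by norm_num) θ) c₀ = 0

/-- **Stub 1 statement — Baily–Borel chart with the Lefschetz triage** (existence; AMRT, the
Baily–Borel class `ℓ = f^* 𝒪(1)` on the toroidal model: trivial on the boundary, big; hard Lefschetz
for `IH•(X^BB)` and purity of `H²(U)`; Hironaka domination of two compactifications by a third). -/
def BailyBorelTriageChart : Prop :=
  ∀ ⦃X : SchemeOver ℂ⦄, IsSmoothProjective 4 X → ∀ (A : HodgeModel 4 X) (Z : Set X.left)
    (S : Set (Matrix (Fin 5) (Fin 5) ℂ)) (N : ℕ), IsClosed Z → 0 < N → S ⊆ eisensteinUnitary →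
    eisensteinUnitaryLevel N ⊆ S → A.IsBallCoveredOff Z S →
    ∃ (X' : SchemeOver ℂ) (_ : IsSmoothProjective 4 X') (A' : HodgeModel 4 X') (Z' : Set X'.left),
      IsClosed Z' ∧ A'.IsBallCoveredOff Z' S ∧
      (∃ (X'' : SchemeOver ℂ) (_ : IsSmoothProjective 4 X'') (p : X'' ⟶ X) (q : X'' ⟶ X'),
        Resolution.IsBirational p.left ∧ Resolution.IsBirational q.left ∧
        (∃ U : X.left.Opens, (U : Set X.left) = Zᶜ ∧ IsIso (p.left ∣_ U)) ∧
        (∃ U' : X'.left.Opens, (U' : Set X'.left) = Z'ᶜ ∧ IsIso (q.left ∣_ U')) ∧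
        p.left.base ⁻¹' Z = q.left.base ⁻¹' Z') ∧
      ∃ ℓ ∈ algebraicClasses X' 1, IsRationalClass ℓ ∧
        singularCohomology.map ℂ ℂ (subsetIncl {P : ComplexPoints X' | P.pt ∈ Z'}) 2 ℓ = 0 ∧
        cupProduct (show 2 * 2 + 2 * 2 = 8 by norm_num)
            (lefschetzOperator ℓ (show 2 + 2 = 2 * 2 by norm_num) ℓ)
            (lefschetzOperator ℓ (show 2 + 2 = 2 * 2 by norm_num) ℓ) ≠ 0 ∧
        ∀ c : complexBetti X' (2 * 2), IsRationalClass c → IsOfHodgeType 4 X' (2 * 2) 2 2 c →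
          singularCohomology.map ℂ ℂ (subsetIncl {P : ComplexPoints X' | P.pt ∈ Z'}) (2 * 2) c = 0 →
          ∃ a ∈ algebraicClasses X' 2, IsRationalClass a ∧
            ∃ c₀ : complexBetti X' (2 * 2), IsRationalClass c₀ ∧ IsOfHodgeType 4 X' (2 * 2) 2 2 c₀ ∧
              singularCohomology.map ℂ ℂ (subsetIncl {P : ComplexPoints X' | P.pt ∈ Z'}) (2 * 2) c₀ = 0 ∧
              IsEllPrimitive X' ℓ c₀ ∧
              complexBetti.restrictCompl X' Z' (2 * 2) (c - a - c₀) = 0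

/-- **Stub 2 statement — the primitive interior core** (OPEN; BMM's excluded middle third for
`U(4,1)`: the `ℓ`-primitive interior rational `(2,2)`-classes — discrete-series type `A_{2,2}` — of a
sector member are algebraic modulo classes supported on the boundary). -/
def PrimitiveInteriorCore : Prop :=
  ∀ ⦃X' : SchemeOver ℂ⦄, IsSmoothProjective 4 X' → ∀ (A' : HodgeModel 4 X') (Z' : Set X'.left)
    (S : Set (Matrix (Fin 5) (Fin 5) ℂ)) (N : ℕ), IsClosed Z' → 0 < N → S ⊆ eisensteinUnitary →
    eisensteinUnitaryLevel N ⊆ S → A'.IsBallCoveredOff Z' S →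
    ∀ ℓ ∈ algebraicClasses X' 1, IsRationalClass ℓ →
      singularCohomology.map ℂ ℂ (subsetIncl {P : ComplexPoints X' | P.pt ∈ Z'}) 2 ℓ = 0 →
      cupProduct (show 2 * 2 + 2 * 2 = 8 by norm_num)
          (lefschetzOperator ℓ (show 2 + 2 = 2 * 2 by norm_num) ℓ)
          (lefschetzOperator ℓ (show 2 + 2 = 2 * 2 by norm_num) ℓ) ≠ 0 →
      ∀ c₀ : complexBetti X' (2 * 2), IsRationalClass c₀ → IsOfHodgeType 4 X' (2 * 2) 2 2 c₀ →
        singularCohomology.map ℂ ℂ (subsetIncl {P : ComplexPoints X' | P.pt ∈ Z'}) (2 * 2) c₀ = 0 →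
        IsEllPrimitive X' ℓ c₀ →
        ∃ a ∈ algebraicClasses X' 2, IsRationalClass a ∧
          complexBetti.restrictCompl X' Z' (2 * 2) (c₀ - a) = 0

/-- **Stub 3 statement — transfer of the interior property along a common modification**
(no coniveau input: `p^* c = q^* c'` by relative-homeomorphism excision, `a := p_* q^* a'`). -/
def InteriorTransfer : Prop :=
  ∀ ⦃X X' X'' : SchemeOver ℂ⦄, IsSmoothProjective 4 X → IsSmoothProjective 4 X' →
    IsSmoothProjective 4 X'' → ∀ (Z : Set X.left) (Z' : Set X'.left), IsClosed Z → IsClosed Z' →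
    ∀ (p : X'' ⟶ X) (q : X'' ⟶ X'), Resolution.IsBirational p.left → Resolution.IsBirational q.left →
    (∃ U : X.left.Opens, (U : Set X.left) = Zᶜ ∧ IsIso (p.left ∣_ U)) →
    (∃ U' : X'.left.Opens, (U' : Set X'.left) = Z'ᶜ ∧ IsIso (q.left ∣_ U')) →
    p.left.base ⁻¹' Z = q.left.base ⁻¹' Z' →
    InteriorAlgebraic X' Z' → InteriorAlgebraic X Z

/-- **Stub 4 statement — classes killed by all boundary threefolds vanish on `Z(ℂ)`** (Deligne
Hodge III 8.2.7 for padded resolutions of the components of `Z`). -/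
def VanishOfTests : Prop :=
  ∀ ⦃X : SchemeOver ℂ⦄, IsSmoothProjective 4 X → ∀ (Z : Set X.left), IsClosed Z →
    ∀ v : complexBetti X (2 * 2),
      (∀ (Y : SchemeOver ℂ) (g : Y ⟶ X), IsSmoothProjective 3 Y → Set.range g.left.base ⊆ Z →
        singularCohomology.map ℂ ℂ (AlgPoints.mapContinuous (L := ℂ) g) (2 * 2) v = 0) →
      singularCohomology.map ℂ ℂ (subsetIncl {P : ComplexPoints X | P.pt ∈ Z}) (2 * 2) v = 0

/-! ### Registered stubs -/

/-- stub 1 — Baily–Borel chart with the Lefschetz triage (known mathematics: AMRT, Zucker's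
conjecture / hard Lefschetz on `IH•(X^BB)`, purity of `H²(U)`, Lefschetz (1,1), Hironaka). -/
theorem stub_bailyBorelTriageChart : BailyBorelTriageChart := by
  sorry

/-- stub 2 — the primitive interior core (OPEN: the automorphic heart of the route). -/
theorem stub_primitiveInteriorCore : PrimitiveInteriorCore := by
  sorry

/-- stub 3 — transfer of the interior property along a common modification. -/
theorem stub_interiorTransfer : InteriorTransfer := by
  sorry

/-- stub 4 — classes killed by all boundary threefolds vanish on `Z(ℂ)` (Deligne 8.2.7). -/
theorem stub_vanishOfTests : VanishOfTests := by
  sorry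

/-! ### Composition -/

/-- **Composition** (no sorry): the four stubs give the piece. -/
theorem towerCuspidalMiddle_of :
    BailyBorelTriageChart → PrimitiveInteriorCore → InteriorTransfer → VanishOfTests →
      Summit.HodgeConjecture.HodgeConjecture.Theses.EisensteinMiddleThird.TowerCuspidalMiddle := by
  intro h₁ h₂ h₃ h₄ X hX A Z S N π hdata c hc hpp htests
  obtain ⟨hZ, hN, hS', hSN', hholo, hcov, hdeck⟩ := hdata
  have hS : S ⊆ eisensteinUnitary := fun γ hγ ↦ hS' γ hγ
  have hSN : eisensteinUnitaryLevel N ⊆ S := fun γ hγ ↦ hSN' γ hγ.1 hγ.2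
  have hA : A.IsBallCoveredOff Z S := ⟨π, hholo, hcov, hdeck⟩
  -- tests ⇒ `c` dies on `Z(ℂ)`
  have hcZ := h₄ hX Z hZ c htests
  -- the chart
  obtain ⟨X', hX', A', Z', hZ', hA', ⟨X'', hX'', p, q, hp, hq, hpU, hqU, hpre⟩, ℓ, hℓ, hℓr, hℓZ,
    hℓ4, htri⟩ := h₁ hX A Z S N hZ hN hS hSN hA
  -- the interior property on the chart: triage + core
  have hX'int : InteriorAlgebraic X' Z' := by
    intro c' hc' hpp' hv'
    obtain ⟨a, ha, har, c₀, hc₀r, hc₀h, hc₀Z, hprim, hrest⟩ := htri c' hc' hpp' hv'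
    obtain ⟨a₀, ha₀, ha₀r, h₀⟩ :=
      h₂ hX' A' Z' S N hZ' hN hS hSN hA' ℓ hℓ hℓr hℓZ hℓ4 c₀ hc₀r hc₀h hc₀Z hprim
    refine ⟨a + a₀, add_mem ha ha₀, har.add ha₀r, ?_⟩
    have hsplit : c' - (a + a₀) = (c' - a - c₀) + (c₀ - a₀) := by abel
    rw [hsplit, map_add, hrest, h₀, add_zero]
  -- transfer to `X`
  exact h₃ hX hX' hX'' Z Z' hZ hZ' p q hp hq hpU hqU hpre hX'int c hc hpp hcZ

/-- The piece from the registered stubs (sorries only inside `stub_*`). -/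
theorem towerCuspidalMiddle_holds_of_stubs : Summit.HodgeConjecture.HodgeConjecture.Theses.EisensteinMiddleThird.TowerCuspidalMiddle :=
  towerCuspidalMiddle_of stub_bailyBorelTriageChart stub_primitiveInteriorCore stub_interiorTransfer
    stub_vanishOfTests

end Summit.HodgeConjecture.HodgeConjecture.Cruxes.EisensteinTowerHodge.SplitCuspidal

end
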